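import Literature.Probability.Percolation.FiveArmFrontier
import HarnessLib

/-!
# The five-arm site of the lowest crossing, II: an open foot with a closed arm to the top (the fifth arm)

Topic `Literature/Probability/Percolation`; family `crit-perc`. PROOFS ONLY (no definition, no named
fact). Second brick of the separation-free proof of the two-radii five-arm lower bound (W. Werner,
PCMI 2009, Lecture 6, §3; P. Nolin, EJP 13 (2008), Thm. 24 (ii) [arXiv 0711.4948: Thm. 23 (ii)]),
see `FiveArmFrontier.lean` for the setting: `κ 0, …, κ n` is an open left–right sequence inside the
explored set of the lowest crossing of `R(M, N)` (`LowSeq`), `aboveSet M N ω` the region above,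
`IsFootO`/`IsFootK` the indices where open/closed paths from the top side land on `κ`.

Nolin (proof of Thm. 24 (ii), arXiv p. 17): "Follow `c` from left to right, and consider the last
vertex `v` before `v₂` that is connected to the top side: it is not hard to see that there is a
white arm from `v` to the top side." We prove this in the following form.

* `LowSeq.isFootK_of_gap` — **the fifth arm.** If `i < j` are an open and a closed foot with no
  open foot in `(i, j]` and no closed foot in `(i, j)`, then `i` is also a closed foot. Proof: apply
  the Hex lemma `tri_hex` in `R(M, N)` to the colouring `X` = (the sites `κ k`, `k ≠ i`, adjacent
  to the region above) ∪ (the open sites of the region above). A bottom–top path of the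
  complementary colour enters the region above for the last time next to an explored site off `X`
  adjacent to the region above, which by the frontier lemma can only be `κ i`, and from there on it
  is a closed path of the region above to the top side — the sought arm. A left–right path of colour
  `X` is impossible: it would contain `κ j` and a site of the open cluster of the witness `o ∼ κ i`
  (both by `PathIn.tri_crossings_meet` against bottom–top paths through `κ j`, `κ i`), but the set
  `Σ` = {`κ k`, `k < i`} ∪ {open sites above whose open cluster has no foot beyond `i`} contains that
  cluster, is closed under `X`-steps (no chord of `κ` over `i`, `LowSeq.no_chord`; a cluster
  straddling `i` contains `o`, `LowSeq.pathIn_of_straddle_footO`; no cluster straddles the closed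
  foot `j`, `LowSeq.no_straddle_footK`; and the two gap hypotheses), and misses `κ j`.
* `LowSeq.exists_doubleFoot`, `LowSeq.exists_doubleFoot'` — hence between any open foot `f₁` and
  any closed foot `f₂` (in either order along `κ`) there is an index that is BOTH an open and a
  closed foot: a site of the lowest crossing with an open and a closed arm to the top side inside
  the region above (take `i` the last open foot before `f₂`, `j` the first closed foot after `i`).

## References

* P. Nolin, Near-critical percolation in two dimensions, *Electron. J. Probab.* 13 (2008)
  1562–1623, §5.2, proof of Thm. 24 (ii) (arXiv 0711.4948: Thm. 23 (ii), p. 17) [Nolin2008].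
* W. Werner, *Lectures on two-dimensional critical percolation*, IAS/Park City Math. Ser. 16
  (2009), Lecture 6, §3; first exercise sheet, "Five-arm exponent" [WernerPCMI2009].
* H. Kesten, *Percolation theory for mathematicians*, Birkhäuser (1982), §2.2–2.3 [KestenPTM1982].
* B. Bollobás, O. Riordan, *Percolation*, CUP (2006), Ch. 7, Lemma 5 (Hex lemma) [BollobasRiordan2006].

## Mathlib / tree

Tree: `tri_hex` (`TriHexLemma.lean`), `PathIn.tri_crossings_meet` (`TriCrossingsMeet.lean`),
`PathIn.exists_support` (`TriRSWChaining.lean`), `PathIn.last_exit` (`SitePaths.lean`), and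
`FiveArmFrontier.lean`. Mathlib: `Nat.findGreatest`, `Nat.find`.
-/

noncomputable section

open Set

namespace Literature.Probability.Percolation

open LatticeModels

variable {M N : ℕ} {ω : Set (Site 2)} {κ : ℕ → Site 2} {n : ℕ}

namespace LowSeq

/-- **The fifth arm** (Nolin 2008, proof of Thm. 24 (ii): "there is a white arm from `v` to the top
side"). Let `i < j ≤ n` be an open foot and a closed foot of the open left–right sequence `κ` inside
the explored set, with no open foot in `(i, j]` and no closed foot in `(i, j)`, and assume the top
side is unexplored. Then `i` is a closed foot as well: some closed site of the region above,
adjacent to `κ i`, is joined to the top side by closed sites of the region above. See the module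
docstring for the proof (Hex lemma in `R(M, N)` for a two-colouring built from `κ` and the region
above; crossing lemma). [cite: Nolin2008, §5.2, proof of Thm. 24 (ii) (arXiv 0711.4948: Thm. 23 (ii), p. 17)] [cite: KestenPTM1982, §2.2–2.3] -/
theorem isFootK_of_gap (h : LowSeq M N ω κ n) (htop : ∀ t ∈ topSide M N, t ∉ explored M N ω)
    {i j : ℕ} (hij : i < j) (hjn : j ≤ n) (hi : IsFootO M N ω κ i) (hj : IsFootK M N ω κ j)
    (hO : ∀ k, i < k → k ≤ j → ¬ IsFootO M N ω κ k)
    (hK : ∀ k, i < k → k < j → ¬ IsFootK M N ω κ k) : IsFootK M N ω κ i := by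
  have hin : i ≤ n := hij.le.trans hjn
  obtain ⟨o, hio, hoA, hoω, t, ht, hot⟩ := hi
  -- the colouring
  set X : Set (Site 2) :=
    {z | ∃ k, k ≤ n ∧ k ≠ i ∧ κ k = z ∧ ∃ g ∈ aboveSet M N ω, triGraph.Adj z g} ∪
      (aboveSet M N ω ∩ ω) with hXdef
  have hXω : ∀ z ∈ X, z ∈ ω := by
    rintro z (⟨k, hk, -, rfl, -⟩ | ⟨-, hz⟩)
    · exact (h.mem hk).2.1
    · exact hz
  rcases tri_hex M N X with ⟨x, hx, y, hy, hπ⟩ | ⟨x, hx, y, hy, hπ⟩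
  · /- (a) a left–right path of colour `X`: impossible -/
    exfalso
    obtain ⟨S, hSsub, hSπ, hS⟩ := hπ.exists_support
    have hx0 : x 0 = 0 := (mem_coe_leftSide.1 (Finset.mem_coe.2 hx)).2
    have hyM : y 0 = M := (mem_coe_rightSide.1 (Finset.mem_coe.2 hy)).2
    have hSR : S ⊆ ↑(rectangle M N) := fun z hz => (hSsub hz).1
    have hSX : S ⊆ X := fun z hz => (hSsub hz).2
    -- (a1) `κ j ∈ S`
    obtain ⟨u, hju, huA, huω, t', ht', hut'⟩ := hj
    have ht'1 : t' 1 = N := (mem_coe_topSide.1 (Finset.mem_coe.2 ht')).2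
    obtain ⟨b₁, hb₁, hQ₁⟩ := exists_bottom_pathIn (h.mem hjn).1 (h.mem hjn).2.1 hju hut'
    have hA₁R : (↑(rectangle M N) ∩ ωᶜ) ∪ {κ j} ∪ (aboveSet M N ω ∩ ωᶜ) ⊆ ↑(rectangle M N) := by
      rintro z ((hz | hz) | hz)
      · exact hz.1
      · rw [mem_singleton_iff.1 hz]; exact Finset.mem_coe.2 (h.mem hjn).2.2
      · exact aboveSet_subset_rectangle hz.1
    obtain ⟨z₁, hz₁S, hz₁'⟩ := PathIn.tri_crossings_meet (L := 0) (R := M) (B := 0) (T := N)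
      (coord_of_subset_rectangle hSR) (coord_of_subset_rectangle hA₁R) hSπ hx0 hyM hQ₁ hb₁ ht'1
    have hjS : κ j ∈ S := by
      rcases hz₁' with (hz | hz) | hz
      · exact absurd (hXω _ (hSX hz₁S)) hz.2
      · rwa [mem_singleton_iff.1 hz] at hz₁S
      · exact absurd (hXω _ (hSX hz₁S)) hz.2
    -- (a2) some `z ∈ S` in the open cluster of `o` above
    set P : Set (Site 2) := {z | PathIn triGraph (aboveSet M N ω ∩ ω) o z} with hPdef
    have hPsub : P ⊆ aboveSet M N ω ∩ ω := fun z hz => hz.right_mem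
    have ht1 : t 1 = N := (mem_coe_topSide.1 (Finset.mem_coe.2 ht)).2
    obtain ⟨b₂, hb₂, hQ₂⟩ := exists_bottom_pathIn (h.mem hin).1 (h.mem hin).2.1 hio hot.pathIn_cluster
    have hA₂R : (↑(rectangle M N) ∩ ωᶜ) ∪ {κ i} ∪ P ⊆ ↑(rectangle M N) := by
      rintro z ((hz | hz) | hz)
      · exact hz.1
      · rw [mem_singleton_iff.1 hz]; exact Finset.mem_coe.2 (h.mem hin).2.2
      · exact aboveSet_subset_rectangle (hPsub hz).1
    obtain ⟨z, hzS, hz'⟩ := PathIn.tri_crossings_meet (L := 0) (R := M) (B := 0) (T := N)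
      (coord_of_subset_rectangle hSR) (coord_of_subset_rectangle hA₂R) hSπ hx0 hyM hQ₂ hb₂ ht1
    have hzP : z ∈ P := by
      rcases hz' with (hz | hz) | hz
      · exact absurd (hXω _ (hSX hzS)) hz.2
      · exfalso
        have hzi : z = κ i := mem_singleton_iff.1 hz
        rcases hSX hzS with ⟨k, hk, hki, hkz, -⟩ | ⟨hzA, -⟩
        · exact hki (h.seq.inj k i hk hin (hkz.trans hzi))
        · exact h.not_mem_aboveSet hin (hzi ▸ hzA)
      · exact hz
    -- the open cluster of `o` has no foot beyond `i`
    have hnofoot : ∀ b, b ≤ n → i < b → ∀ y', triGraph.Adj (κ b) y' →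
        ¬ PathIn triGraph (aboveSet M N ω ∩ ω) o y' := by
      intro b hbn hib y' hby' hoy'
      have hfootO : IsFootO M N ω κ b :=
        ⟨y', hby', hoy'.right_mem.1, hoy'.right_mem.2, t, ht, hoy'.symm.trans hot⟩
      rcases le_or_gt b j with hbj | hjb
      · exact hO b hib hbj hfootO
      · exact h.no_straddle_footK hij hjb hbn hio hby' hoy' ⟨u, hju, huA, huω, t', ht', hut'⟩
    -- (a3) the invariant set
    set Sg : Set (Site 2) := {z | ∃ k, k ≤ n ∧ k < i ∧ κ k = z} ∪
      {z | (z ∈ aboveSet M N ω ∧ z ∈ ω) ∧ ∀ b, b ≤ n → i < b → ∀ y', triGraph.Adj (κ b) y' →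
        ¬ PathIn triGraph (aboveSet M N ω ∩ ω) z y'} with hSgdef
    have hzSg : z ∈ Sg := Or.inr ⟨hPsub hzP, fun b hbn hib y' hby' hzy' =>
      hnofoot b hbn hib y' hby' ((show PathIn triGraph _ o z from hzP).trans hzy')⟩
    have hstep : ∀ s w, s ∈ Sg → w ∈ X → triGraph.Adj s w → w ∈ Sg := by
      intro s w hs hw hsw
      rcases hs with ⟨k, hk, hki, rfl⟩ | ⟨⟨hsA, hsω⟩, hs⟩
      · -- `s = κ k`, `k < i`
        rcases hw with ⟨k', hk', hk'i, rfl, g, hg, hk'g⟩ | ⟨hwA, hwω⟩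
        · refine Or.inl ⟨k', hk', ?_, rfl⟩
          by_contra hle
          have hik' : i < k' := lt_of_le_of_ne (not_lt.1 hle) (Ne.symm hk'i)
          exact h.no_chord hki hik' hk' hsw hoA hio
        · refine Or.inr ⟨⟨hwA, hwω⟩, fun b hbn hib y' hby' hwy' => ?_⟩
          have hwo : PathIn triGraph (aboveSet M N ω ∩ ω) w o :=
            h.pathIn_of_straddle_footO hki hib hbn hsw hby' (PathIn.refl ⟨hwA, hwω⟩) hwy' hio hot ht
          exact hnofoot b hbn hib y' hby' (hwo.symm.trans hwy')
      · -- `s` open above, its cluster without foot beyond `i`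
        rcases hw with ⟨k', hk', hk'i, rfl, g, hg, hk'g⟩ | ⟨hwA, hwω⟩
        · refine Or.inl ⟨k', hk', ?_, rfl⟩
          by_contra hle
          have hik' : i < k' := lt_of_le_of_ne (not_lt.1 hle) (Ne.symm hk'i)
          exact hs k' hk' hik' s hsw.symm (PathIn.refl ⟨hsA, hsω⟩)
        · have hsw' : PathIn triGraph (aboveSet M N ω ∩ ω) s w :=
            PathIn.of_adj (show s ∈ aboveSet M N ω ∩ ω from ⟨hsA, hsω⟩) ⟨hwA, hwω⟩ hsw
          exact Or.inr ⟨⟨hwA, hwω⟩, fun b hbn hib y' hby' hwy' =>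
            hs b hbn hib y' hby' (hsw'.trans hwy')⟩
    -- propagate from `z` to `κ j` along the path inside `S`
    have hzj : PathIn triGraph S z (κ j) := (hS z hzS).symm.trans (hS _ hjS)
    have hend : ∀ e, Relation.ReflTransGen (fun a b => triGraph.Adj a b ∧ b ∈ S) z e → e ∈ Sg := by
      intro e hrel
      induction hrel with
      | refl => exact hzSg
      | @tail c d _ hcd ih => exact hstep c d ih (hSX hcd.2) hcd.1
    rcases hend _ hzj.2 with ⟨k, hk, hki, hkj⟩ | ⟨⟨hjA, -⟩, -⟩
    · have := h.seq.inj k j hk hjn hkj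
      omega
    · exact h.not_mem_aboveSet hjn hjA
  · /- (b) a bottom–top path of the complementary colour: the closed arm from `κ i` -/
    have hxC : x ∈ (aboveSet M N ω)ᶜ := fun hxA =>
      (mem_rectangle_of_mem_aboveSet hxA).2 (bottomSide_subset_explored ω hx)
    have hyA : y ∈ aboveSet M N ω := mem_aboveSet_of_mem_topSide hy (htop y hy)
    obtain ⟨a, b', haC, haX, hb'C, hab', hp⟩ :=
      hπ.last_exit (C := (aboveSet M N ω)ᶜ) hxC (fun hyC => hyC hyA)
    have hb'A : b' ∈ aboveSet M N ω := not_not.1 hb'C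
    -- from `b'` on, a closed path of the region above to the top side
    have hp' : PathIn triGraph (aboveSet M N ω ∩ ωᶜ) b' y := by
      refine hp.mono ?_
      rintro z ⟨⟨-, hzX⟩, hzC⟩
      have hzA : z ∈ aboveSet M N ω := not_not.1 hzC
      exact ⟨hzA, fun hzω => hzX (Or.inr ⟨hzA, hzω⟩)⟩
    -- `a` is explored, hence `a = κ k`, and `k = i` since `a ∉ X`
    have haE : a ∈ explored M N ω := by
      by_contra haE
      exact haC (mem_aboveSet_of_adj hb'A hab'.symm (Finset.mem_coe.1 haX.1) haE)
    obtain ⟨k, hk, hka⟩ := h.exists_eq_of_adj_aboveSet haE hb'A hab'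
    have hki : k = i := by
      by_contra hki
      exact haX.2 (Or.inl ⟨k, hk, hki, hka, b', hb'A, hka ▸ hab'⟩)
    subst hki
    exact ⟨b', hka ▸ hab', hb'A, hp'.left_mem.2, y, hy, hp'⟩

/-- **A double foot exists** (Nolin 2008, proof of Thm. 24 (ii): the site `v` of the lowest
crossing with a black and a white arm to the top side). If `f₁ ≤ f₂ ≤ n` are an open and a closed
foot and the top side is unexplored, some index `i ∈ [f₁, f₂]` is both an open and a closed foot:
take `i` the largest open foot in `[f₁, f₂]` (`Nat.findGreatest`); if it is not a closed foot, the
least closed foot `j` in `(i, f₂]` (`Nat.find`) satisfies the gap hypotheses of `isFootK_of_gap`. [cite: Nolin2008, §5.2, proof of Thm. 24 (ii) (arXiv 0711.4948: p. 17)] -/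
theorem exists_doubleFoot (h : LowSeq M N ω κ n) (htop : ∀ t ∈ topSide M N, t ∉ explored M N ω)
    {f₁ f₂ : ℕ} (hf : f₁ ≤ f₂) (hf₂n : f₂ ≤ n) (h₁ : IsFootO M N ω κ f₁) (h₂ : IsFootK M N ω κ f₂) :
    ∃ i, f₁ ≤ i ∧ i ≤ f₂ ∧ IsFootO M N ω κ i ∧ IsFootK M N ω κ i := by
  classical
  set i : ℕ := Nat.findGreatest (fun k => IsFootO M N ω κ k) f₂ with hidef
  have hf₁i : f₁ ≤ i := Nat.le_findGreatest hf h₁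
  have hif₂ : i ≤ f₂ := Nat.findGreatest_le f₂
  have hiO : IsFootO M N ω κ i := Nat.findGreatest_spec hf h₁
  have hmax : ∀ k, i < k → k ≤ f₂ → ¬ IsFootO M N ω κ k := fun k hik hkf =>
    Nat.findGreatest_is_greatest hik hkf
  by_cases hiK : IsFootK M N ω κ i
  · exact ⟨i, hf₁i, hif₂, hiO, hiK⟩
  · exfalso
    have hne : i ≠ f₂ := fun heq => hiK (heq ▸ h₂)
    have hex : ∃ k, i < k ∧ k ≤ f₂ ∧ IsFootK M N ω κ k := ⟨f₂, lt_of_le_of_ne hif₂ hne, le_rfl, h₂⟩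
    set j : ℕ := Nat.find hex with hjdef
    obtain ⟨hij, hjf₂, hjK⟩ := Nat.find_spec hex
    have hmin : ∀ k, i < k → k < j → ¬ IsFootK M N ω κ k := fun k hik hkj hkK =>
      Nat.find_min hex hkj ⟨hik, (hkj.le.trans hjf₂), hkK⟩
    exact hiK (h.isFootK_of_gap htop hij (hjf₂.trans hf₂n) hiO hjK
      (fun k hik hkj => hmax k hik (hkj.trans hjf₂)) hmin)

/-- **A double foot exists, in either order** of the two feet along `κ` (reverse the sequence when
the closed foot comes first; `IsFootO`/`IsFootK` only involve the site `κ k`). [cite: Nolin2008, §5.2, proof of Thm. 24 (ii) (arXiv 0711.4948: p. 17)] -/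
theorem exists_doubleFoot' (h : LowSeq M N ω κ n) (htop : ∀ t ∈ topSide M N, t ∉ explored M N ω)
    {f₁ f₂ : ℕ} (hf₁n : f₁ ≤ n) (hf₂n : f₂ ≤ n) (h₁ : IsFootO M N ω κ f₁) (h₂ : IsFootK M N ω κ f₂) :
    ∃ i, min f₁ f₂ ≤ i ∧ i ≤ max f₁ f₂ ∧ IsFootO M N ω κ i ∧ IsFootK M N ω κ i := by
  rcases le_or_gt f₁ f₂ with hf | hf
  · obtain ⟨i, h1, h2, hO, hK⟩ := h.exists_doubleFoot htop hf hf₂n h₁ h₂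
    exact ⟨i, by rw [min_eq_left hf]; exact h1, by rw [max_eq_right hf]; exact h2, hO, hK⟩
  · have h₁' : IsFootO M N ω (fun k => κ (n - k)) (n - f₁) := by
      show IsFootO M N ω κ (n - (n - f₁))
      rw [Nat.sub_sub_self hf₁n]; exact h₁
    have h₂' : IsFootK M N ω (fun k => κ (n - k)) (n - f₂) := by
      show IsFootK M N ω κ (n - (n - f₂))
      rw [Nat.sub_sub_self hf₂n]; exact h₂
    obtain ⟨i, h1, h2, hO, hK⟩ :=
      h.reverse.exists_doubleFoot htop (by omega) (Nat.sub_le n f₂) h₁' h₂'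
    refine ⟨n - i, ?_, ?_, hO, hK⟩
    · rw [min_eq_right hf.le]; omega
    · rw [max_eq_left hf.le]; omega

end LowSeq

end Literature.Probability.Percolation
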